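import Literature.NumberTheory.Transcendental.KZSemiCanonicalReductionProofs
import Literature.NumberTheory.Transcendental.EllIterRep
import Summits.KontsevichZagierPeriods.KontsevichZagierPeriods.Theorems.SymplecticScissorsVolumeFormOffPlaneTriExists

/-!
# `VolumeFormOffPlane` (stmt-KontsevichZagierPeriods-14935) — line `Sketch`,
stub `stub_simplexExists` (simplex and order-cell representations exist)

Box-dimension `n` (total dimension `n + 1`), box coordinates `x_ι = p (Fin.castSucc ι)` and slack
`z = p (Fin.last n)` subject to `0 < z ∧ z · ∏ x_ι < 1`. For `g` real algebraic the two shapes are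

* the corner-`1` log-simplex `S(g) = {1 < x_ι (∀ ι), ∏ x_ι < g, slack}`;
* the order cell `O_σ(g) = {ι ↦ x_{σ ι} strictly increasing} ∩ {1 < x_ι < g (∀ ι)} ∩ slack`
  for a permutation `σ` of the box coordinates.

Each is `ℚ`-semialgebraic (polynomial inequalities with rational coefficients, the sublevel set
`{∏ x_ι < g}` and the half-spaces `{x_ι < g}` at the real-algebraic, hence `ℚ`-definable, level `g`;
strict monotonicity along `σ` is the finite conjunction `x_{σ a} < x_{σ b}`, `a < b`) and bounded
(in `S(g)` every `x_ι ≤ ∏ x_j < g` since the other factors exceed `1`, and `z < 1` since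
`∏ x_j ≥ 1`), hence of finite volume; `KZ.exists_oneRep` then provides the representation `∫ 1`.

Sources: Kontsevich–Zagier 2001, §1.1 (semialgebraic domains, "rational" may be replaced by
"algebraic"); Bochnak–Coste–Roy 1998, §2.2.
-/

noncomputable section

open MeasureTheory Set MvPolynomial
open Literature.NumberTheory.Transcendental Literature.ModelTheory.ExponentialFields

namespace Summit.KontsevichZagierPeriods.SymplecticScissors.LogPolytope

/-! ## The slack condition in dimension `n + 1` -/

/-- The slack region `{0 < z, z · ∏ x_ι < 1}` is `ℚ`-semialgebraic. [folklore] -/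
theorem sxe_isSemialgebraic_slack (n : ℕ) :
    IsSemialgebraic ℚ {p : Fin (n + 1) → ℝ | 0 < p (Fin.last n) ∧
      p (Fin.last n) * ∏ ι : Fin n, p (Fin.castSucc ι) < 1} := by
  have hz : IsSemialgebraic ℚ {p : Fin (n + 1) → ℝ | 0 < p (Fin.last n)} := by
    have h := isSemialgebraic_setOf_eval_pos (k := ℚ) (R := ℝ)
      (X (Fin.last n) : MvPolynomial (Fin (n + 1)) ℚ)
    simpa using h
  have hprod : IsSemialgebraic ℚ {p : Fin (n + 1) → ℝ |
      p (Fin.last n) * ∏ ι : Fin n, p (Fin.castSucc ι) < 1} := by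
    have h := isSemialgebraic_setOf_eval_lt (k := ℚ) (R := ℝ)
      (X (Fin.last n) * ∏ ι : Fin n, X (Fin.castSucc ι) : MvPolynomial (Fin (n + 1)) ℚ) (C 1)
    simpa [map_prod] using h
  exact hz.inter hprod

/-- On the slack region over box coordinates exceeding `1`, the slack coordinate is at most `1`:
`z ≤ z · ∏ x_ι < 1`. [folklore] -/
theorem sxe_last_le_one {n : ℕ} {p : Fin (n + 1) → ℝ} (hbox : ∀ ι : Fin n, 1 < p (Fin.castSucc ι))
    (hz : 0 < p (Fin.last n)) (hprod : p (Fin.last n) * ∏ ι : Fin n, p (Fin.castSucc ι) < 1) :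
    p (Fin.last n) ≤ 1 := by
  have hP : 1 ≤ ∏ ι : Fin n, p (Fin.castSucc ι) := Finset.one_le_prod fun ι _ => (hbox ι).le
  nlinarith [mul_le_mul_of_nonneg_left hP hz.le]

/-! ## The corner-`1` log-simplex -/

/-- The corner-`1` log-simplex `{1 < x_ι, ∏ x_ι < g, slack}` with real-algebraic `g` is
`ℚ`-semialgebraic. [folklore] -/
theorem sxe_isSemialgebraic_simplex {n : ℕ} {g : ℝ} (hg : IsAlgebraic ℚ g) :
    IsSemialgebraic ℚ {p : Fin (n + 1) → ℝ | (∀ ι : Fin n, 1 < p (Fin.castSucc ι)) ∧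
      ∏ ι : Fin n, p (Fin.castSucc ι) < g ∧ 0 < p (Fin.last n) ∧
      p (Fin.last n) * ∏ ι : Fin n, p (Fin.castSucc ι) < 1} := by
  have hbox : IsSemialgebraic ℚ (⋂ ι ∈ (Finset.univ : Finset (Fin n)),
      {p : Fin (n + 1) → ℝ | 1 < p (Fin.castSucc ι)}) :=
    IsSemialgebraic.biInter _ _ fun ι _ => by
      have h := isSemialgebraic_setOf_eval_lt (k := ℚ) (R := ℝ)
        (C 1 : MvPolynomial (Fin (n + 1)) ℚ) (X (Fin.castSucc ι))
      simpa using h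
  have hlt : IsSemialgebraic ℚ {p : Fin (n + 1) → ℝ | ∏ ι : Fin n, p (Fin.castSucc ι) < g} := by
    have h := tre_isSemialgebraic_setOf_aeval_lt_const
      (∏ ι : Fin n, X (Fin.castSucc ι) : MvPolynomial (Fin (n + 1)) ℚ) hg
    simpa [map_prod] using h
  have hset : {p : Fin (n + 1) → ℝ | (∀ ι : Fin n, 1 < p (Fin.castSucc ι)) ∧
      ∏ ι : Fin n, p (Fin.castSucc ι) < g ∧ 0 < p (Fin.last n) ∧
      p (Fin.last n) * ∏ ι : Fin n, p (Fin.castSucc ι) < 1} =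
      (⋂ ι ∈ (Finset.univ : Finset (Fin n)), {p : Fin (n + 1) → ℝ | 1 < p (Fin.castSucc ι)}) ∩
        {p | ∏ ι : Fin n, p (Fin.castSucc ι) < g} ∩
        {p | 0 < p (Fin.last n) ∧ p (Fin.last n) * ∏ ι : Fin n, p (Fin.castSucc ι) < 1} := by
    ext p
    simp [and_assoc]
  rw [hset]
  exact (hbox.inter hlt).inter (sxe_isSemialgebraic_slack n)

/-- The corner-`1` log-simplex lies in the compact box `[0, max g 1]ⁿ⁺¹`: each `x_ι ≤ ∏ x_j < g`
(the other factors exceed `1`) and `z ≤ 1`. [folklore] -/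
theorem sxe_simplex_subset_Icc {n : ℕ} (g : ℝ) :
    {p : Fin (n + 1) → ℝ | (∀ ι : Fin n, 1 < p (Fin.castSucc ι)) ∧
      ∏ ι : Fin n, p (Fin.castSucc ι) < g ∧ 0 < p (Fin.last n) ∧
      p (Fin.last n) * ∏ ι : Fin n, p (Fin.castSucc ι) < 1} ⊆
    Icc (0 : Fin (n + 1) → ℝ) (fun _ => max g 1) := by
  rintro p ⟨hbox, hg, hz, hprod⟩
  have hzle : p (Fin.last n) ≤ 1 := sxe_last_le_one hbox hz hprod
  have hxle : ∀ ι : Fin n, p (Fin.castSucc ι) ≤ ∏ j : Fin n, p (Fin.castSucc j) := fun ι => by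
    have h := Finset.prod_le_prod_of_subset_of_one_le (f := fun j : Fin n => p (Fin.castSucc j))
      (Finset.subset_univ {ι}) (fun j _ => (zero_lt_one.trans (hbox j)).le)
      (fun j _ _ => (hbox j).le)
    simpa using h
  constructor
  · intro i
    induction i using Fin.lastCases with
    | last => simpa using hz.le
    | cast j => simpa using (zero_lt_one.trans (hbox j)).le
  · intro i
    induction i using Fin.lastCases with
    | last => exact le_max_of_le_right hzle
    | cast j => exact le_max_of_le_left ((hxle j).trans hg.le)

/-! ## The order cells -/

/-- Strict monotonicity of the box coordinates along a permutation `σ` cuts out a `ℚ`-semialgebraic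
set (finite intersection of `x_{σ b} − x_{σ a} > 0`, `a < b`). [folklore] -/
theorem sxe_isSemialgebraic_setOf_strictMono (n : ℕ) (σ : Equiv.Perm (Fin n)) :
    IsSemialgebraic ℚ {p : Fin (n + 1) → ℝ |
      StrictMono (fun ι : Fin n => p (Fin.castSucc (σ ι)))} := by
  have : {p : Fin (n + 1) → ℝ | StrictMono (fun ι : Fin n => p (Fin.castSucc (σ ι)))} =
      ⋂ q ∈ (Finset.univ.filter fun q : Fin n × Fin n => q.1 < q.2),
        {t | 0 < aeval t (X (Fin.castSucc (σ q.2)) - X (Fin.castSucc (σ q.1)) :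
          MvPolynomial (Fin (n + 1)) ℚ)} := by
    ext t
    simp only [mem_setOf_eq, Finset.mem_filter, Finset.mem_univ, true_and, mem_iInter,
      map_sub, aeval_X, sub_pos, Prod.forall]
    exact ⟨fun h a b hab => h hab, fun h a b hab => h a b hab⟩
  rw [this]
  exact IsSemialgebraic.biInter _ _ fun q _ => isSemialgebraic_setOf_eval_pos (k := ℚ) _

/-- The order cell `O_σ(g)` with real-algebraic `g` is `ℚ`-semialgebraic. [folklore] -/
theorem sxe_isSemialgebraic_orderCell {n : ℕ} {g : ℝ} (hg : IsAlgebraic ℚ g)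
    (σ : Equiv.Perm (Fin n)) :
    IsSemialgebraic ℚ {p : Fin (n + 1) → ℝ |
      StrictMono (fun ι : Fin n => p (Fin.castSucc (σ ι))) ∧
      (∀ ι : Fin n, 1 < p (Fin.castSucc ι) ∧ p (Fin.castSucc ι) < g) ∧ 0 < p (Fin.last n) ∧
      p (Fin.last n) * ∏ ι : Fin n, p (Fin.castSucc ι) < 1} := by
  have hcube : IsSemialgebraic ℚ (⋂ ι ∈ (Finset.univ : Finset (Fin n)),
      ({p : Fin (n + 1) → ℝ | 1 < p (Fin.castSucc ι)} ∩ {p | p (Fin.castSucc ι) < g})) :=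
    IsSemialgebraic.biInter _ _ fun ι _ => by
      have h := isSemialgebraic_setOf_eval_lt (k := ℚ) (R := ℝ)
        (C 1 : MvPolynomial (Fin (n + 1)) ℚ) (X (Fin.castSucc ι))
      have h1 : IsSemialgebraic ℚ {p : Fin (n + 1) → ℝ | 1 < p (Fin.castSucc ι)} := by
        simpa using h
      exact h1.inter (KZ.isSemialgebraic_setOf_apply_lt_const hg _)
  have hset : {p : Fin (n + 1) → ℝ | StrictMono (fun ι : Fin n => p (Fin.castSucc (σ ι))) ∧
      (∀ ι : Fin n, 1 < p (Fin.castSucc ι) ∧ p (Fin.castSucc ι) < g) ∧ 0 < p (Fin.last n) ∧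
      p (Fin.last n) * ∏ ι : Fin n, p (Fin.castSucc ι) < 1} =
      {p : Fin (n + 1) → ℝ | StrictMono (fun ι : Fin n => p (Fin.castSucc (σ ι)))} ∩
        (⋂ ι ∈ (Finset.univ : Finset (Fin n)),
          ({p : Fin (n + 1) → ℝ | 1 < p (Fin.castSucc ι)} ∩ {p | p (Fin.castSucc ι) < g})) ∩
        {p | 0 < p (Fin.last n) ∧ p (Fin.last n) * ∏ ι : Fin n, p (Fin.castSucc ι) < 1} := by
    ext p
    simp [and_assoc, forall_and]
  rw [hset]
  exact ((sxe_isSemialgebraic_setOf_strictMono n σ).inter hcube).inter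
    (sxe_isSemialgebraic_slack n)

/-- The order cell `O_σ(g)` lies in the compact box `[0, max g 1]ⁿ⁺¹` (`1 < x_ι < g` and `z ≤ 1`).
[folklore] -/
theorem sxe_orderCell_subset_Icc {n : ℕ} (g : ℝ) (σ : Equiv.Perm (Fin n)) :
    {p : Fin (n + 1) → ℝ | StrictMono (fun ι : Fin n => p (Fin.castSucc (σ ι))) ∧
      (∀ ι : Fin n, 1 < p (Fin.castSucc ι) ∧ p (Fin.castSucc ι) < g) ∧ 0 < p (Fin.last n) ∧
      p (Fin.last n) * ∏ ι : Fin n, p (Fin.castSucc ι) < 1} ⊆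
    Icc (0 : Fin (n + 1) → ℝ) (fun _ => max g 1) := by
  rintro p ⟨-, hbox, hz, hprod⟩
  have hzle : p (Fin.last n) ≤ 1 := sxe_last_le_one (fun ι => (hbox ι).1) hz hprod
  constructor
  · intro i
    induction i using Fin.lastCases with
    | last => simpa using hz.le
    | cast j => simpa using (zero_lt_one.trans (hbox j).1).le
  · intro i
    induction i using Fin.lastCases with
    | last => exact le_max_of_le_right hzle
    | cast j => exact le_max_of_le_left (hbox j).2.le

/-! ## The stub -/

/-- **Stub (simplex and order-cell representations exist).** For `g` real algebraic, the corner-`1`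
log-simplex `{1 < x_ι, ∏ x_ι < g, slack}` and every order cell `O_σ(g)` carry integrand-`1`
representations (`ℚ`-semialgebraic — `StrictMono` along `σ` is the finite conjunction
`x_{σ a} < x_{σ b}`, `a < b` — and bounded; `KZ.exists_oneRep`). [folklore] -/
theorem stub_simplexExists : (∀ (n : ℕ) (g : ℝ), IsAlgebraic ℚ g → (∃ r : KZ.IntegralRep (n + 1), r.domain = {p : Fin ((n) + 1) → ℝ | (∀ ι : Fin (n), 1 < p (Fin.castSucc ι)) ∧ ∏ ι : Fin (n), p (Fin.castSucc ι) < g ∧ 0 < p (Fin.last (n)) ∧ p (Fin.last (n)) * ∏ ι : Fin (n), p (Fin.castSucc ι) < 1} ∧ r.integrand = fun _ => 1) ∧ (∀ σ : Equiv.Perm (Fin n), ∃ r : KZ.IntegralRep (n + 1), r.domain = {p : Fin ((n) + 1) → ℝ | StrictMono (fun ι : Fin (n) => p (Fin.castSucc (σ ι))) ∧ (∀ ι : Fin (n), 1 < p (Fin.castSucc ι) ∧ p (Fin.castSucc ι) < g) ∧ 0 < p (Fin.last (n)) ∧ p (Fin.last (n)) * ∏ ι : Fin (n), p (Fin.castSucc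 ι) < 1} ∧ r.integrand = fun _ => 1)) := by
  intro n g hg
  refine ⟨?_, fun σ => ?_⟩
  · exact KZ.exists_oneRep (sxe_isSemialgebraic_simplex hg)
      (((measure_mono (sxe_simplex_subset_Icc g)).trans_lt isCompact_Icc.measure_lt_top).ne)
  · exact KZ.exists_oneRep (sxe_isSemialgebraic_orderCell hg σ)
      (((measure_mono (sxe_orderCell_subset_Icc g σ)).trans_lt isCompact_Icc.measure_lt_top).ne)

end Summit.KontsevichZagierPeriods.SymplecticScissors.LogPolytope

end
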